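import Summits.QuantumFields.YangMills.Theorems.ColdStartUniversalityLatticeLangevinDynkinSmooth
import Summits.QuantumFields.YangMills.Theorems.ColdStartUniversalityLatticeLangevinRegularFlowProgressive
import Summits.QuantumFields.YangMills.Theorems.ColdStartUniversalityLatticeLangevinCoeffBounds
import Literature.Analysis.FunctionSpaces.ItoProcessesProofs
import HarnessLib

/-!
# Route `ColdStartUniversality` (fixed-cut-off SZZ dynamics; conjugation calculus, file 1):
# DYNKIN'S FORMULA IN EXPECTATION FOR A PAIR OF SZZ SOLUTIONS DRIVEN BY THE SAME NOISE

Helper file (seat `ym-line-csu-p1`, g23).  Two regular solution families `U false`, `U true` of the SU(2) lattice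
Langevin (Shen–Zhu–Zhu) system on `(ℤ/L)³` at couplings `β false`, `β true`, on ONE probability space, driven by ONE
flat Brownian motion `W` (raw natural filtration `𝓕 = hW.natFiltration`), started at `x false`, `x true`.  The PAIR
of processes `(U false (x false), U true (x true))`, read in the real coordinates
`(s, e, i, j, c) ↦ Re/Im ρ(U s (x s) r ω e)_{ij}`, is ONE vector Itô process driven by the coordinates of `W` — the two
components share the noise coordinate `(e, n)` — so the generic Dynkin formula in expectation of seat g6
(`dynkin_expectation_flat_of_contDiff`) applies to every `C³` compactly supported test function of the PAIR:

* `isStronglyProgressive_comp_flow₂`, `measurable_comp_flow₂_toNNReal` — observables of the pair along two regular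
  flows are progressive / jointly measurable;
* ★ `dynkin_expectation_pair` — `E[Z (f(X_t) - f(X_s))] = E[Z ∫_(s,t] (L^{pair} f)(X_r) dr]` with the pair generator
  `Σ_a ∂_a f b_a + ½ Σ_{a,a'} ∂_a ∂_{a'} f Σ_n σ_{a n} σ_{a' n}` (cross terms between the two solutions present: same
  noise).

This is the input of the conjugation identity `(U²)ᴴ U¹ = … + ∫ (U²)ᴴ (D₁ − D₂) U¹ dr` (sibling files).  THEOREMS ONLY, no
sorry.  HONEST FRAMING: fixed-cut-off stochastic-calculus plumbing; nothing K-uniform; no crux, rung or summit statement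
is proved; the Yang–Mills mass gap is NOT proved.
-/

set_option autoImplicit false

noncomputable section

namespace Summit.QuantumFields.YangMills.Theorems.ColdStartUniversality

open MeasureTheory ProbabilityTheory Finset
open scoped NNReal
open Literature.Probability.Process Literature.MathematicalPhysics.QuantumFieldTheory
open Literature.MathematicalPhysics.QuantumLattice (fundamentalRep fundamentalLatticeRep continuous_fundamentalRep)

variable {Ω : Type*} {mΩ : MeasurableSpace Ω} {𝓕 : Filtration ℝ≥0 mΩ} {L : ℕ}

/-! ## Observables of a PAIR of regular flows -/

/-- Measurability of a section of two jointly measurable maps composed with a two-argument observable. [folklore] -/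
theorem measurable_comp_section₂ {A G Ω' : Type*} [MeasurableSpace A] [MeasurableSpace G] [MeasurableSpace Ω']
    {V V' : A × (G × Ω') → G} (hV : Measurable V) (hV' : Measurable V') (x y : G) {φ : G → G → ℝ}
    (hφ : Measurable fun p : G × G => φ p.1 p.2) :
    Measurable fun p : A × Ω' => φ (V (p.1, (x, p.2))) (V' (p.1, (y, p.2))) := by
  have h1 : Measurable fun p : A × Ω' => V (p.1, (x, p.2)) :=
    hV.comp (measurable_fst.prodMk (measurable_const.prodMk measurable_snd))
  have h2 : Measurable fun p : A × Ω' => V' (p.1, (y, p.2)) :=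
    hV'.comp (measurable_fst.prodMk (measurable_const.prodMk measurable_snd))
  exact hφ.comp (h1.prodMk h2)

/-- **Observables of a pair of progressively measurable flows are progressive**: for two solution families with the
regular-flow measurability clause, two starts `x, y` and a jointly measurable `φ`, `(r, ω) ↦ φ (U x r ω) (U' y r ω)` is
strongly progressive. [folklore] -/
theorem isStronglyProgressive_comp_flow₂
    {U U' : GaugeConfig 3 L (Matrix.specialUnitaryGroup (Fin 2) ℂ) → ℝ≥0 → Ω →
      GaugeConfig 3 L (Matrix.specialUnitaryGroup (Fin 2) ℂ)}
    (hU : ∀ i : ℝ≥0, Measurable[@Prod.instMeasurableSpace (Set.Iic i)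
        (GaugeConfig 3 L (Matrix.specialUnitaryGroup (Fin 2) ℂ) × Ω) inferInstance
        (@Prod.instMeasurableSpace (GaugeConfig 3 L (Matrix.specialUnitaryGroup (Fin 2) ℂ)) Ω inferInstance (𝓕 i))]
      (fun q : Set.Iic i × (GaugeConfig 3 L (Matrix.specialUnitaryGroup (Fin 2) ℂ) × Ω) => U q.2.1 q.1 q.2.2))
    (hU' : ∀ i : ℝ≥0, Measurable[@Prod.instMeasurableSpace (Set.Iic i)
        (GaugeConfig 3 L (Matrix.specialUnitaryGroup (Fin 2) ℂ) × Ω) inferInstance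
        (@Prod.instMeasurableSpace (GaugeConfig 3 L (Matrix.specialUnitaryGroup (Fin 2) ℂ)) Ω inferInstance (𝓕 i))]
      (fun q : Set.Iic i × (GaugeConfig 3 L (Matrix.specialUnitaryGroup (Fin 2) ℂ) × Ω) => U' q.2.1 q.1 q.2.2))
    (x y : GaugeConfig 3 L (Matrix.specialUnitaryGroup (Fin 2) ℂ))
    {φ : GaugeConfig 3 L (Matrix.specialUnitaryGroup (Fin 2) ℂ) →
      GaugeConfig 3 L (Matrix.specialUnitaryGroup (Fin 2) ℂ) → ℝ}
    (hφ : Measurable fun p : GaugeConfig 3 L (Matrix.specialUnitaryGroup (Fin 2) ℂ) ×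
      GaugeConfig 3 L (Matrix.specialUnitaryGroup (Fin 2) ℂ) => φ p.1 p.2) :
    IsStronglyProgressive 𝓕 (fun r ω => φ (U x r ω) (U' y r ω)) := by
  intro i
  have h := @measurable_comp_section₂ (Set.Iic i) (GaugeConfig 3 L (Matrix.specialUnitaryGroup (Fin 2) ℂ)) Ω
    inferInstance inferInstance (𝓕 i) _ _ (hU i) (hU' i) x y φ hφ
  exact h.stronglyMeasurable

/-- **Joint measurability of pair observables along two regular flows**: `(ω, r) ↦ φ (U x r⁺ ω) (U' y r⁺ ω)` is
measurable on `Ω × ℝ`. [folklore] -/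
theorem measurable_comp_flow₂_toNNReal
    {U U' : GaugeConfig 3 L (Matrix.specialUnitaryGroup (Fin 2) ℂ) → ℝ≥0 → Ω →
      GaugeConfig 3 L (Matrix.specialUnitaryGroup (Fin 2) ℂ)}
    (hU : ∀ i : ℝ≥0, Measurable[@Prod.instMeasurableSpace (Set.Iic i)
        (GaugeConfig 3 L (Matrix.specialUnitaryGroup (Fin 2) ℂ) × Ω) inferInstance
        (@Prod.instMeasurableSpace (GaugeConfig 3 L (Matrix.specialUnitaryGroup (Fin 2) ℂ)) Ω inferInstance (𝓕 i))]
      (fun q : Set.Iic i × (GaugeConfig 3 L (Matrix.specialUnitaryGroup (Fin 2) ℂ) × Ω) => U q.2.1 q.1 q.2.2))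
    (hU' : ∀ i : ℝ≥0, Measurable[@Prod.instMeasurableSpace (Set.Iic i)
        (GaugeConfig 3 L (Matrix.specialUnitaryGroup (Fin 2) ℂ) × Ω) inferInstance
        (@Prod.instMeasurableSpace (GaugeConfig 3 L (Matrix.specialUnitaryGroup (Fin 2) ℂ)) Ω inferInstance (𝓕 i))]
      (fun q : Set.Iic i × (GaugeConfig 3 L (Matrix.specialUnitaryGroup (Fin 2) ℂ) × Ω) => U' q.2.1 q.1 q.2.2))
    (x y : GaugeConfig 3 L (Matrix.specialUnitaryGroup (Fin 2) ℂ))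
    {φ : GaugeConfig 3 L (Matrix.specialUnitaryGroup (Fin 2) ℂ) →
      GaugeConfig 3 L (Matrix.specialUnitaryGroup (Fin 2) ℂ) → ℝ}
    (hφ : Measurable fun p : GaugeConfig 3 L (Matrix.specialUnitaryGroup (Fin 2) ℂ) ×
      GaugeConfig 3 L (Matrix.specialUnitaryGroup (Fin 2) ℂ) => φ p.1 p.2) :
    Measurable fun p : Ω × ℝ => φ (U x p.2.toNNReal p.1) (U' y p.2.toNNReal p.1) :=
  measurable_toNNReal_of_isStronglyProgressive (isStronglyProgressive_comp_flow₂ hU hU' x y hφ)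

/-! ## Dynkin's formula for the pair -/

/-- ★ **Dynkin's formula in expectation for a PAIR of SZZ solutions driven by the same flat noise.**  For two regular
solution families `U s` (`s : Bool`) at couplings `β s` on one filtered probability space with one flat Brownian motion
`W`, starts `x s`, a `C³` compactly supported test function `f` of the real coordinates of the PAIR of link-matrix
configurations, `s₀ ≤ t` and a bounded `𝓕_{s₀}`-measurable `Z`:
`E[Z (f(X_t) - f(X_{s₀}))] = E[Z ∫_(s₀,t] (L^{pair} f)(X_r) dr]`, where the coordinate `(s, e, i, j, c)` of `X` is
`Re/Im ρ(U s (x s) r ω e)_{ij}`, its drift `b` and noise coefficients `σ` (against the flat coordinate `(e', n)`,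
vanishing for `e' ≠ e`) are those of `latticeLangevinDynamics _ (β s)`, and the two components SHARE the noise
coordinates. [folklore] -/
theorem dynkin_expectation_pair (L : ℕ) [NeZero L] (β : Bool → ℝ) {Ω : Type} [MeasurableSpace Ω] {P : Measure Ω}
    [IsProbabilityMeasure P] {W : ℝ≥0 → Ω → (Edge 3 L × NoiseIdx 2 → ℝ)} (hW : IsFlatBrownian W P)
    (U : Bool → GaugeConfig 3 L (Matrix.specialUnitaryGroup (Fin 2) ℂ) → ℝ≥0 → Ω →
      GaugeConfig 3 L (Matrix.specialUnitaryGroup (Fin 2) ℂ))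
    (hU : ∀ s x, (∀ ω, U s x 0 ω = x) ∧
      (latticeLangevinDynamics (fundamentalLatticeRep 2) (β s)).IsSolution (fundamentalRep (Fin 2))
        hW.natFiltration P W (U s x))
    (hUm : ∀ (s : Bool) (i : ℝ≥0), Measurable[@Prod.instMeasurableSpace (Set.Iic i)
        (GaugeConfig 3 L (Matrix.specialUnitaryGroup (Fin 2) ℂ) × Ω) inferInstance
        (@Prod.instMeasurableSpace (GaugeConfig 3 L (Matrix.specialUnitaryGroup (Fin 2) ℂ)) Ω inferInstance
          (hW.natFiltration i))]
      (fun q : Set.Iic i × (GaugeConfig 3 L (Matrix.specialUnitaryGroup (Fin 2) ℂ) × Ω) => U s q.2.1 q.1 q.2.2))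
    (x : Bool → GaugeConfig 3 L (Matrix.specialUnitaryGroup (Fin 2) ℂ))
    {f : (Bool × (Edge 3 L × Fin 2 × Fin 2 × Bool) → ℝ) → ℝ} (hf : ContDiff ℝ 3 f) (hfc : HasCompactSupport f)
    {s₀ t : ℝ≥0} (hst : s₀ ≤ t) {Z : Ω → ℝ} (hZ : StronglyMeasurable[hW.natFiltration s₀] Z) {C : ℝ}
    (hC : ∀ ω, |Z ω| ≤ C) :
    let X : ℝ≥0 → Ω → (Bool × (Edge 3 L × Fin 2 × Fin 2 × Bool) → ℝ) := fun r ω a =>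
      (fun z : ℂ => if a.2.2.2.2 then z.im else z.re) ((fundamentalRep (Fin 2) (U a.1 (x a.1) r ω a.2.1) : Matrix (Fin 2) (Fin 2) ℂ) a.2.2.1 a.2.2.2.1)
    let b : (Bool × (Edge 3 L × Fin 2 × Fin 2 × Bool)) → ℝ≥0 → Ω → ℝ := fun a r ω =>
      (fun z : ℂ => if a.2.2.2.2 then z.im else z.re) ((latticeLangevinDynamics (fundamentalLatticeRep 2) (β a.1)).drift
        (matrixConfig (fundamentalRep (Fin 2)) (U a.1 (x a.1) r ω)) a.2.1 a.2.2.1 a.2.2.2.1)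
    let σ : (Bool × (Edge 3 L × Fin 2 × Fin 2 × Bool)) → (Edge 3 L × NoiseIdx 2) → ℝ≥0 → Ω → ℝ := fun a k r ω =>
      if k.1 = a.2.1 then (fun z : ℂ => if a.2.2.2.2 then z.im else z.re)
        ((latticeLangevinDynamics (fundamentalLatticeRep 2) (β a.1)).noise
          (matrixConfig (fundamentalRep (Fin 2)) (U a.1 (x a.1) r ω)) a.2.1 k.2 a.2.2.1 a.2.2.2.1) else 0
    ∫ ω, Z ω * (f (X t ω) - f (X s₀ ω)) ∂P =
      ∫ ω, Z ω * (∫ r in Set.Ioc (s₀ : ℝ) t,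
        (∑ a, fderiv ℝ f (X r.toNNReal ω) (Pi.single a 1) * b a r.toNNReal ω +
        (1 / 2) * ∑ a, ∑ a', fderiv ℝ (fun z ↦ fderiv ℝ f z (Pi.single a 1)) (X r.toNNReal ω) (Pi.single a' 1) *
          ∑ n, σ a n r.toNNReal ω * σ a' n r.toNNReal ω)) ∂P := by
  intro X b σ
  classical
  haveI := secondCountableTopology_su2
  haveI := borelSpace_config L
  -- coefficient bounds, uniform over the two couplings
  obtain ⟨M₀, hM₀⟩ := exists_bound_coeff (L := L) (β false)
  obtain ⟨M₁, hM₁⟩ := exists_bound_coeff (L := L) (β true)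
  set M : ℝ := max M₀ M₁ with hMdef
  have hM : ∀ (s : Bool) (V : GaugeConfig 3 L (Matrix.specialUnitaryGroup (Fin 2) ℂ)) (e : Edge 3 L) (i j : Fin 2),
      ‖(latticeLangevinDynamics (fundamentalLatticeRep 2) (β s)).drift (matrixConfig (fundamentalRep (Fin 2)) V) e i j‖
          ≤ M ∧
        ∀ n : NoiseIdx 2, ‖(latticeLangevinDynamics (fundamentalLatticeRep 2) (β s)).noise
          (matrixConfig (fundamentalRep (Fin 2)) V) e n i j‖ ≤ M := by
    intro s V e i j
    cases s
    · exact ⟨(hM₀ V e i j).1.trans (le_max_left _ _), fun n => ((hM₀ V e i j).2 n).trans (le_max_left _ _)⟩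
    · exact ⟨(hM₁ V e i j).1.trans (le_max_right _ _), fun n => ((hM₁ V e i j).2 n).trans (le_max_right _ _)⟩
  have hreIm : ∀ (c : Bool) (z : ℂ), |(fun z : ℂ => if c then z.im else z.re) z| ≤ ‖z‖ := by
    intro c z; cases c
    · simpa using Complex.abs_re_le_norm z
    · simpa using Complex.abs_im_le_norm z
  -- measurability of the coordinate observables
  have hentry : ∀ (e : Edge 3 L) (i j : Fin 2) (c : Bool), Measurable fun V : GaugeConfig 3 L
      (Matrix.specialUnitaryGroup (Fin 2) ℂ) =>
        (fun z : ℂ => if c then z.im else z.re) ((fundamentalRep (Fin 2) (V e) : Matrix (Fin 2) (Fin 2) ℂ) i j) := by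
    intro e i j c
    have hc : Continuous fun V : GaugeConfig 3 L (Matrix.specialUnitaryGroup (Fin 2) ℂ) =>
        ((fundamentalRep (Fin 2) (V e) : Matrix (Fin 2) (Fin 2) ℂ) i j) :=
      (continuous_apply j).comp ((continuous_apply i).comp
        ((continuous_fundamentalRep (n := Fin 2)).comp (continuous_apply e)))
    cases c
    · exact (Complex.continuous_re.comp hc).measurable
    · exact (Complex.continuous_im.comp hc).measurable
  have hdriftm : ∀ (s : Bool) (e : Edge 3 L) (i j : Fin 2) (c : Bool), Measurable fun V : GaugeConfig 3 L
      (Matrix.specialUnitaryGroup (Fin 2) ℂ) =>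
      (fun z : ℂ => if c then z.im else z.re) ((latticeLangevinDynamics (fundamentalLatticeRep 2) (β s)).drift
        (matrixConfig (fundamentalRep (Fin 2)) V) e i j) := by
    intro s e i j c
    have hc : Continuous fun V : GaugeConfig 3 L (Matrix.specialUnitaryGroup (Fin 2) ℂ) =>
        (latticeLangevinDynamics (fundamentalLatticeRep 2) (β s)).drift (matrixConfig (fundamentalRep (Fin 2)) V) e i j :=
      (continuous_apply j).comp ((continuous_apply i).comp (continuous_drift_matrixConfig (β s) e))
    cases c
    · exact (Complex.continuous_re.comp hc).measurable
    · exact (Complex.continuous_im.comp hc).measurable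
  have hnoisem : ∀ (s : Bool) (e : Edge 3 L) (n : NoiseIdx 2) (i j : Fin 2) (c : Bool), Measurable
      fun V : GaugeConfig 3 L (Matrix.specialUnitaryGroup (Fin 2) ℂ) =>
      (fun z : ℂ => if c then z.im else z.re) ((latticeLangevinDynamics (fundamentalLatticeRep 2) (β s)).noise
        (matrixConfig (fundamentalRep (Fin 2)) V) e n i j) := by
    intro s e n i j c
    have hc : Continuous fun V : GaugeConfig 3 L (Matrix.specialUnitaryGroup (Fin 2) ℂ) =>
        (latticeLangevinDynamics (fundamentalLatticeRep 2) (β s)).noise (matrixConfig (fundamentalRep (Fin 2)) V) e n i j :=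
      (continuous_apply j).comp ((continuous_apply i).comp (continuous_noise_matrixConfig (β s) e n))
    cases c
    · exact (Complex.continuous_re.comp hc).measurable
    · exact (Complex.continuous_im.comp hc).measurable
  -- the Itô integrals: each solution's complex ones, and zero integrals for the other links
  have hsol : ∀ s, (latticeLangevinDynamics (fundamentalLatticeRep 2) (β s)).IsSolution (fundamentalRep (Fin 2))
      hW.natFiltration P W (U s (x s)) := fun s => (hU s (x s)).2
  choose Jc hJc hXeqC using fun s => (hsol s).exists_ito
  have hzero : ∀ k : Edge 3 L × NoiseIdx 2, ∃ J0 : ℝ≥0 → Ω → ℝ,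
      IsItoIntegral (fun _ _ => (0 : ℝ)) (fun r ω => W r ω k) J0 hW.natFiltration P ∧
        ∀ᵐ ω ∂P, ∀ t, J0 t ω = 0 := by
    intro k
    obtain ⟨J0, hJ0, -, -⟩ := exists_isItoIntegral_flatCoord hW k (H := fun _ _ => (0 : ℝ))
      (isStronglyProgressive_const _ _) (fun t => by simp [sqErr])
    exact ⟨J0, hJ0, IsItoIntegral.ae_forall_eq_zero_of_integrand hJ0⟩
  choose J0 hJ0 hJ0z using hzero
  set J : (Bool × (Edge 3 L × Fin 2 × Fin 2 × Bool)) → (Edge 3 L × NoiseIdx 2) → ℝ≥0 → Ω → ℝ := fun a k =>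
    if k.1 = a.2.1 then (fun t ω => (fun z : ℂ => if a.2.2.2.2 then z.im else z.re) (Jc a.1 a.2.1 k.2 a.2.2.1 a.2.2.2.1 t ω))
    else J0 k with hJdef
  refine dynkin_expectation_flat_of_contDiff (J := J) hW ?_ ?_ (M := M) ?_ ?_ ?_ ?_ ?_ ?_ hf hfc hst hZ hC
  · -- `b` progressive
    intro a
    exact isStronglyProgressive_comp_flow (hUm a.1) (x a.1) (hdriftm a.1 a.2.1 a.2.2.1 a.2.2.2.1 a.2.2.2.2)
  · -- `σ` progressive
    intro a k
    by_cases hk : k.1 = a.2.1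
    · have h := isStronglyProgressive_comp_flow (hUm a.1) (x a.1)
        (hnoisem a.1 a.2.1 k.2 a.2.2.1 a.2.2.2.1 a.2.2.2.2)
      have e1 : σ a k = fun r ω => (fun z : ℂ => if a.2.2.2.2 then z.im else z.re)
          ((latticeLangevinDynamics (fundamentalLatticeRep 2) (β a.1)).noise
            (matrixConfig (fundamentalRep (Fin 2)) (U a.1 (x a.1) r ω)) a.2.1 k.2 a.2.2.1 a.2.2.2.1) := by
        funext r ω
        simp only [σ, hk, if_true]
      rw [e1]; exact h
    · have h := isStronglyProgressive_const hW.natFiltration (0 : ℝ)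
      refine (show σ a k = fun _ _ => (0 : ℝ) from ?_) ▸ h
      funext r ω
      simp only [σ, hk, if_false]
  · -- `|b| ≤ M`
    intro a r ω
    exact (hreIm _ _).trans (hM a.1 (U a.1 (x a.1) r ω) a.2.1 a.2.2.1 a.2.2.2.1).1
  · -- `|σ| ≤ M`
    intro a k r ω
    have hM0 : 0 ≤ M := (norm_nonneg _).trans (hM a.1 (U a.1 (x a.1) r ω) a.2.1 a.2.2.1 a.2.2.2.1).1
    by_cases hk : k.1 = a.2.1
    · simp only [σ, hk, if_true]
      exact (hreIm _ _).trans ((hM a.1 (U a.1 (x a.1) r ω) a.2.1 a.2.2.1 a.2.2.2.1).2 k.2)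
    · simp only [σ, hk, if_false, abs_zero]; exact hM0
  · -- the Itô integrals
    intro a k
    by_cases hk : k.1 = a.2.1
    · obtain ⟨e', n⟩ := k
      rcases a with ⟨s, e, i, j, c⟩
      simp only at hk
      obtain rfl : e' = e := hk
      have h := hJc s e' n i j
      have e2 : J (s, e', i, j, c) (e', n) = fun t ω => (fun z : ℂ => if c then z.im else z.re) (Jc s e' n i j t ω) := by
        simp only [hJdef, if_true]
      have e1 : σ (s, e', i, j, c) (e', n) = fun t ω => (fun z : ℂ => if c then z.im else z.re)
          ((latticeLangevinDynamics (fundamentalLatticeRep 2) (β s)).noise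
            (matrixConfig (fundamentalRep (Fin 2)) (U s (x s) t ω)) e' n i j) := by
        funext t ω; simp only [σ, if_true]
      rw [e1, e2]
      cases c
      · simp only [Bool.false_eq_true, if_false]
        convert h.1 using 0
        exact Iff.rfl
      · simp only [if_true]
        convert h.2 using 0
        exact Iff.rfl
    · have h := hJ0 k
      have e1 : σ a k = fun _ _ => (0 : ℝ) := by funext r ω; simp only [σ, hk, if_false]
      have e2 : J a k = J0 k := by simp only [hJdef, hk, if_false]
      rw [e1, e2]; exact h
  · -- joint measurability of `X`
    intro a
    exact measurable_comp_flow_toNNReal (hUm a.1) (x a.1) (hentry a.2.1 a.2.2.1 a.2.2.2.1 a.2.2.2.2)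
  · -- adaptedness of `X`
    intro a t
    have h1 : Measurable[hW.natFiltration t] (U a.1 (x a.1) t) := (hsol a.1).adapted t
    exact ((hentry a.2.1 a.2.2.1 a.2.2.2.1 a.2.2.2.2).comp h1).stronglyMeasurable
  · -- the integral equations, coordinatewise
    intro a
    rcases a with ⟨s, e, i, j, c⟩
    have hJ0all : ∀ᵐ ω ∂P, ∀ k, ∀ t, J0 k t ω = 0 := ae_all_iff.mpr fun k => hJ0z k
    filter_upwards [hXeqC s, hJ0all, (hsol s).continuous] with ω hω hω0 hωc
    intro t
    have hCx : ((fundamentalRep (Fin 2) (U s (x s) t ω e) : Matrix (Fin 2) (Fin 2) ℂ) i j) =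
        ((fundamentalRep (Fin 2) (U s (x s) 0 ω e) : Matrix (Fin 2) (Fin 2) ℂ) i j) +
        (∫ r in (0 : ℝ)..t, (latticeLangevinDynamics (fundamentalLatticeRep 2) (β s)).drift
          (matrixConfig (fundamentalRep (Fin 2)) (U s (x s) r.toNNReal ω)) e i j) + ∑ n, Jc s e n i j t ω :=
      hω t e i j
    have hFc : Continuous fun r : ℝ => (latticeLangevinDynamics (fundamentalLatticeRep 2) (β s)).drift
        (matrixConfig (fundamentalRep (Fin 2)) (U s (x s) r.toNNReal ω)) e i j := by
      have h1 : Continuous fun r : ℝ => U s (x s) r.toNNReal ω := hωc.comp continuous_real_toNNReal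
      have h2 := (continuous_drift_matrixConfig (β s) e).comp h1
      exact (continuous_apply j).comp ((continuous_apply i).comp h2)
    have hii : IntervalIntegrable (fun r : ℝ => (latticeLangevinDynamics (fundamentalLatticeRep 2) (β s)).drift
        (matrixConfig (fundamentalRep (Fin 2)) (U s (x s) r.toNNReal ω)) e i j) volume (0 : ℝ) t :=
      hFc.intervalIntegrable _ _
    have hsum : (∑ k : Edge 3 L × NoiseIdx 2, J (s, e, i, j, c) k t ω) =
        ∑ n : NoiseIdx 2, (fun z : ℂ => if c then z.im else z.re) (Jc s e n i j t ω) := by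
      rw [Fintype.sum_prod_type, Finset.sum_eq_single e]
      · simp only [hJdef, if_true]
      · intro e' _ hne
        simp only [hJdef, hne, if_false]
        exact Finset.sum_eq_zero fun n _ => hω0 (e', n) t
      · intro h; exact absurd (Finset.mem_univ e) h
    rw [hsum]
    cases c
    · have hint := Complex.reCLM.intervalIntegral_comp_comm hii
      simp only [Complex.reCLM_apply] at hint
      have hre := congrArg Complex.re hCx
      rw [Complex.add_re, Complex.add_re, ← hint, Complex.re_sum] at hre
      simp only [X, b, Bool.false_eq_true, if_false]
      exact hre
    · have hint := Complex.imCLM.intervalIntegral_comp_comm hii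
      simp only [Complex.imCLM_apply] at hint
      have him := congrArg Complex.im hCx
      rw [Complex.add_im, Complex.add_im, ← hint, Complex.im_sum] at him
      simp only [X, b, if_true]
      exact him

end Summit.QuantumFields.YangMills.Theorems.ColdStartUniversality

end
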